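import Summits.BirchSwinnertonDyer.BirchSwinnertonDyer.Theorems.ByReductionTypeAtTwoRankOneAtTwoOffBigImageOddLocalArchBoundaryNorm
import HarnessLib

/-!
# Route `ByReductionTypeAtTwo`, crux `RankOneAtTwoOffBigImageOddLocal` (stmt-BirchSwinnertonDyer-23716), line
# `refined_kolyvagin_tamagawa_shift_at_two`, stub `stub_sigmaShiftPosDisc`: the norm of the Kolyvagin derivative at a complex
# conjugation, GENERAL CLASS NUMBER — partner PAIRS of cosets contribute NORMS ONLY (pure algebra, PROVED)

Lead prover `prover-cruxlead-stmt-BirchSwinnertonDyer-23716-g11` (2026-08-29), `--supports stmt-BirchSwinnertonDyer-23716`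
(helper; closes nothing).  THEOREMS ONLY (no definition, no named fact, no `sorry`).  Sequel to
`…OffBigImageOddLocalArchBoundaryNorm` (p687908: the case `h_K = 1`, one coset) and companion of memo
`Cruxes/RankOneAtTwoOffBigImageOddLocal/ArchBoundaryBitAtTwo.md` §2 («General `K`»).

SETTING.  `P_ℓ = Σ_{s ∈ S} s D_ℓ y_ℓ` with `S` a set of coset representatives of `G_ℓ = ⟨σ⟩` in `G = Gal(K_ℓ/K)`
(abelian: the commutative group ring `R`), `τ g = g⁻¹ τ` (`τ (g • x) = g′ • τ x`, `g g′ = 1`), `τ y_ℓ = σ₀ • y_ℓ`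
(Gross Prop. 5.3, `Φ(0) = 0`).  The PARTNER involution `s ↦ s̃` on `S` (`s⁻¹σ₀ ∈ s̃ G_ℓ`, i.e. `s′σ₀ = s̃ σ^k`, then also
`s̃′σ₀ = s σ^k` with the SAME `k`; the tree's `c ↦ [𝔫]·c⁻¹` of `HeegnerPointsGenusHalfTraceProofs`) has two kinds of orbits:

* PAIRS `s ≠ s̃` (`norm_pair_kolyvaginDerivative_smul`): `N_τ((s + s̃) D y) = Z + τ Z` with the EXPLICIT
  `Z = −m • (s Σ_{j≤k} σ^j) • y + (m+k) • (s Tr) • y` — a NORM outright: such cosets contribute NOTHING to the class of the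
  `2^M`-th root of `P_ℓ + τP_ℓ` in `E(F)/N_τ E(K_ℓ)`, whatever the parities of `(ℓ+1)/2^M`, `a_ℓ/2^M`;
* SELF-PARTNERS `s = s̃` (`σ₀ ∈ s² G_ℓ`): with `y′ = s • y` one has `τ y′ = σ^k • y′` (`map_smul_eq_pow_smul_of_self_partner`),
  so p687908's one-coset theorems apply VERBATIM to `y′` (`norm_kolyvaginDerivative_smul_of_self_partner`): the contribution is
  `[u odd][k even]·[s σ^{k/2} y_ℓ] + [v(m+k) odd]·[s Tr y_ℓ / 2^M-part]`, `s σ^{k/2}` a square root of `σ₀` in the coset `sG_ℓ`.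

Hence (memo §2, general `K`): `[R] = [u odd]·Σ_{s = s̃, k(s) even} [g_s y_ℓ] + [v odd]·Σ_{s = s̃, k(s) odd} [s y_1]` in
`Ĥ⁰(⟨τ⟩, E(K_ℓ))`; the self-partner cosets with `k` even are exactly the cosets containing a square root of `σ₀` (`|G[2]|/2` of
them if `σ₀ ∈ G²`, none otherwise).  BSD is NOT proved by any of this; the crux is NOT proved; the stub is NOT proved.

References: [GrossLMS1991] §3 (3.5), §4 (4.1) (`P_n = Σ_{σ ∈ 𝒢/G_n} σ D_n y_n`), Prop. 5.3; [McCallumLMS1991] §5;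
[Cox2013] §3.B, §7 (genera, the principal genus = squares).
-/

set_option linter.dupNamespace false -- tree convention: `Summit.BirchSwinnertonDyer.BirchSwinnertonDyer.Theorems` (summit = sub-problem)
set_option autoImplicit false

open Finset

namespace Summit.BirchSwinnertonDyer.BirchSwinnertonDyer.Theorems.OffBigImageOddLocalAtTwo.ArchBoundaryNorm

variable {R : Type*} [CommRing R] {M : Type*} [AddCommGroup M] [Module R M]

/-! ## §4 Self-partner cosets reduce to the one-coset case -/

/-- **Self-partner coset**: if `s s′ = 1`, `τ (s • x) = s′ • τ x`, `τ y = σ₀ • y` and `s′ σ₀ = s σ^k` (the coset `s G_ℓ`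
is its own partner: `σ₀ ∈ s² G_ℓ`), then `y′ = s • y` satisfies `τ y′ = σ^k • y′` — the hypothesis of p687908's one-coset
theorems with `k₀ = k`. [cite: GrossLMS1991, Prop. 5.3] -/
theorem map_smul_eq_pow_smul_of_self_partner {σ s s' σ₀ : R} {k : ℕ} (τ : M →+ M)
    (hτs : ∀ x : M, τ (s • x) = s' • τ x) {y : M} (hy : τ y = σ₀ • y) (hs : s' * σ₀ = s * σ ^ k) :
    τ (s • y) = σ ^ k • s • y := by
  rw [hτs, hy, ← mul_smul, hs, mul_comm, mul_smul]

/-- **Self-partner coset, the dihedral identity transported**: under the hypotheses of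
`map_smul_eq_pow_smul_of_self_partner` and `σ σ′ = 1`, `σ^m = 1`, `τ (σ • x) = σ′ • τ x`:
`(sD) • y + τ ((sD) • y) = −(m • Σ_{j≤k} σ^j • s • y) + (m + k) • Tr • s • y` (p687908's `norm_kolyvaginDerivative_smul`
for `y′ = s • y`). [cite: GrossLMS1991, Prop. 5.3 and §3 (3.5)] -/
theorem norm_kolyvaginDerivative_smul_of_self_partner {σ σ' s s' σ₀ : R} {m k : ℕ} (hσσ' : σ * σ' = 1)
    (hσ : σ ^ m = 1) (τ : M →+ M) (hτ : ∀ x : M, τ (σ • x) = σ' • τ x) (hτs : ∀ x : M, τ (s • x) = s' • τ x)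
    {y : M} (hy : τ y = σ₀ • y) (hs : s' * σ₀ = s * σ ^ k) :
    (s * ∑ i ∈ range m, (i : R) * σ ^ i) • y + τ ((s * ∑ i ∈ range m, (i : R) * σ ^ i) • y) =
      -((m : R) • ∑ j ∈ range (k + 1), σ ^ j • s • y) + ((m + k : ℕ) : R) • (∑ i ∈ range m, σ ^ i) • s • y := by
  rw [mul_comm s, mul_smul]
  exact norm_kolyvaginDerivative_smul hσσ' hσ τ hτ (map_smul_eq_pow_smul_of_self_partner τ hτs hy hs)

/-! ## §5 Partner pairs contribute norms only -/

/-- `τ ((g D) • y) = (g′ σ₀ (m (Tr − 1) − D)) • y` for a group-like `g` (`g g′ = 1`, `τ (g • x) = g′ • τ x`) and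
`τ y = σ₀ • y`: the conjugate of the `g`-translate of the derived point (reflection identity of p687908).
[cite: GrossLMS1991, Prop. 5.3 (proof)] -/
theorem map_mul_kolyvaginDerivative_smul {σ σ' g g' σ₀ : R} {m : ℕ} (hσσ' : σ * σ' = 1) (hσ : σ ^ m = 1)
    (τ : M →+ M) (hτ : ∀ x : M, τ (σ • x) = σ' • τ x) (hτg : ∀ x : M, τ (g • x) = g' • τ x)
    {y : M} (hy : τ y = σ₀ • y) :
    τ ((g * ∑ i ∈ range m, (i : R) * σ ^ i) • y) =
      (g' * σ₀ * ((m : R) * ((∑ i ∈ range m, σ ^ i) - 1) - ∑ i ∈ range m, (i : R) * σ ^ i)) • y := by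
  rw [mul_smul, hτg, sum_smul, map_sum, smul_sum, ← sum_natCast_mul_inv_pow_eq hσσ' hσ, mul_sum, sum_smul]
  refine sum_congr rfl fun i _ ↦ ?_
  rw [mul_smul, map_natCast_smul, map_pow_smul τ hτ, hy]
  simp only [← mul_smul]
  congr 1
  ring

/-- The ring identity behind both halves of the pair lemma: `σ^k (m (Tr − 1) − D) = (m+k) Tr − D − m Σ_{j≤k} σ^j`
(`σ^k Tr = Tr`, `σ^k D = D + (Σ_{j<k} σ^j)(m − Tr)`, `(Σ_{j<k} σ^j) Tr = k Tr`). [cite: GrossLMS1991, §3 (3.5)] -/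
theorem pow_mul_reflect_eq {σ : R} {m : ℕ} (hσ : σ ^ m = 1) (k : ℕ) :
    σ ^ k * ((m : R) * ((∑ i ∈ range m, σ ^ i) - 1) - ∑ i ∈ range m, (i : R) * σ ^ i) =
      ((m + k : ℕ) : R) * (∑ i ∈ range m, σ ^ i) - (∑ i ∈ range m, (i : R) * σ ^ i) -
        (m : R) * ∑ j ∈ range (k + 1), σ ^ j := by
  have hT := pow_mul_trace_eq hσ k
  have hD := pow_mul_kolyvaginDerivative_eq hσ k
  have hG := geom_sum_mul_trace_eq hσ k
  have e1 : σ ^ k * ((m : R) * ((∑ i ∈ range m, σ ^ i) - 1) - ∑ i ∈ range m, (i : R) * σ ^ i) =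
      (m : R) * (σ ^ k * ∑ i ∈ range m, σ ^ i) - (m : R) * σ ^ k - σ ^ k * ∑ i ∈ range m, (i : R) * σ ^ i := by ring
  rw [e1, hT, hD, sum_range_succ]
  have e2 : (∑ j ∈ range k, σ ^ j) * ((m : R) - ∑ i ∈ range m, σ ^ i) =
      (m : R) * (∑ j ∈ range k, σ ^ j) - (∑ j ∈ range k, σ ^ j) * ∑ i ∈ range m, σ ^ i := by ring
  rw [e2, hG]
  push_cast
  ring

/-- For `σ σ′ = 1`, `σ^m = 1`: the trace of `σ′ = σ⁻¹` is the trace of `σ`, `Σ_{i<m} σ′^i = Σ_{i<m} σ^i`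
(`σ′^i = σ^{m−i}`, reindex). [folklore] -/
theorem sum_inv_pow_eq_trace {σ σ' : R} {m : ℕ} (hσσ' : σ * σ' = 1) (hσ : σ ^ m = 1) :
    ∑ i ∈ range m, σ' ^ i = ∑ i ∈ range m, σ ^ i := by
  have hrefl : ∀ i ∈ range m, σ' ^ i = σ ^ (m - 1 - i) * σ := by
    intro i hi
    rw [mem_range] at hi
    obtain ⟨d, hd⟩ := Nat.exists_eq_add_of_le (show i + 1 ≤ m by omega)
    have h1 : m - 1 - i = d := by omega
    have h2 : σ ^ (m - 1 - i) * σ * σ ^ i = 1 := by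
      rw [h1, ← pow_succ, ← pow_add, show d + 1 + i = m by omega, hσ]
    calc σ' ^ i = σ' ^ i * (σ ^ (m - 1 - i) * σ * σ ^ i) := by rw [h2, mul_one]
      _ = σ ^ (m - 1 - i) * σ * (σ * σ') ^ i := by rw [mul_pow]; ring
      _ = σ ^ (m - 1 - i) * σ := by rw [hσσ', one_pow, mul_one]
  rw [sum_congr rfl hrefl, ← sum_mul, sum_range_reflect (fun i ↦ σ ^ i) m, mul_comm, mul_trace_eq hσ]

/-- `τ` maps the `s`-translate of the interval sum onto the `t`-translate: `τ (s • (Σ_{j≤k} σ^j) • y) = t • (Σ_{j≤k} σ^j) • y`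
for partners `s′σ₀ = tσ^k` (`τ (sσ^j y) = t σ^{k−j} y`, then reindex). [cite: GrossLMS1991, Prop. 5.3 (proof)] -/
theorem map_smul_sum_pow_smul_of_partner {σ σ' s s' t σ₀ : R} {k : ℕ} (hσσ' : σ * σ' = 1) (τ : M →+ M)
    (hτ : ∀ x : M, τ (σ • x) = σ' • τ x) (hτs : ∀ x : M, τ (s • x) = s' • τ x) {y : M} (hy : τ y = σ₀ • y)
    (hst : s' * σ₀ = t * σ ^ k) :
    τ (s • (∑ j ∈ range (k + 1), σ ^ j) • y) = t • (∑ j ∈ range (k + 1), σ ^ j) • y := by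
  have hterm : ∀ j ∈ range (k + 1), s' • τ (σ ^ j • y) = (t * σ ^ (k + 1 - 1 - j)) • y := by
    intro j hj
    rw [mem_range] at hj
    rw [map_pow_smul τ hτ, hy]
    simp only [← mul_smul]
    congr 1
    obtain ⟨d, hd⟩ := Nat.exists_eq_add_of_le (show j ≤ k by omega)
    have hkj : k + 1 - 1 - j = d := by omega
    have key : s' * σ₀ * σ' ^ j = t * σ ^ d := by
      calc s' * σ₀ * σ' ^ j = t * σ ^ k * σ' ^ j := by rw [hst]
        _ = t * σ ^ d * (σ * σ') ^ j := by rw [hd, pow_add, mul_pow]; ring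
        _ = t * σ ^ d := by rw [hσσ', one_pow, mul_one]
    rw [hkj, ← key]
    ring
  conv_lhs => rw [hτs, sum_smul, map_sum, smul_sum]
  rw [sum_congr rfl hterm, sum_range_reflect (fun j ↦ (t * σ ^ j) • y) (k + 1), sum_smul, smul_sum]
  refine sum_congr rfl fun j _ ↦ ?_
  rw [mul_smul]

/-- `τ (s • Tr • y) = t • Tr • y` for partners `s′σ₀ = tσ^k` (`Tr(σ′) = Tr(σ)` and `σ^k Tr = Tr`). [cite: GrossLMS1991, §3 (3.5)] -/
theorem map_smul_trace_smul_of_partner {σ σ' s s' t σ₀ : R} {m k : ℕ} (hσσ' : σ * σ' = 1) (hσ : σ ^ m = 1)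
    (τ : M →+ M) (hτ : ∀ x : M, τ (σ • x) = σ' • τ x) (hτs : ∀ x : M, τ (s • x) = s' • τ x) {y : M}
    (hy : τ y = σ₀ • y) (hst : s' * σ₀ = t * σ ^ k) :
    τ (s • (∑ i ∈ range m, σ ^ i) • y) = t • (∑ i ∈ range m, σ ^ i) • y := by
  have hterm : ∀ i ∈ range m, s' • τ (σ ^ i • y) = ((s' * σ₀) * σ' ^ i) • y := by
    intro i _
    rw [map_pow_smul τ hτ, hy]
    simp only [← mul_smul]
    congr 1
    ring
  conv_lhs => rw [hτs, sum_smul, map_sum, smul_sum]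
  rw [sum_congr rfl hterm, ← sum_smul, ← mul_sum, hst, mul_assoc, sum_inv_pow_eq_trace hσσ' hσ,
    pow_mul_trace_eq hσ, mul_smul]

/-- **PARTNER PAIRS CONTRIBUTE NORMS ONLY.**  Let `R` be commutative (`ℤ[Gal(K_ℓ/K)]`) acting on `M` (`E(K_ℓ)`), `σ σ′ = 1`,
`σ^m = 1`, `τ` additive with `τ (σ • x) = σ′ • τ x`, and `s, t ∈ R` group-like for `τ` (`τ (s • x) = s′ • τ x`,
`τ (t • x) = t′ • τ x`) forming a PARTNER PAIR for `σ₀` (`τ y = σ₀ • y`): `s′ σ₀ = t σ^k` and `t′ σ₀ = s σ^k` (the SAME `k`).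
Then with `D = Σ_{i<m} i σ^i`, `Tr = Σ_{i<m} σ^i`, `G_k = Σ_{j≤k} σ^j` and the explicit
`Z = −(m • s • G_k • y) + (m + k) • s • Tr • y`:
`((s + t) D) • y + τ (((s + t) D) • y) = Z + τ Z` — the two cosets' share of `P_ℓ + τ P_ℓ` is a τ-NORM of an EXPLICIT point,
so (memo §2) they contribute nothing to the class of the `2^M`-th root in `E(F)/N_τ E(K_ℓ)`: only SELF-PARTNER cosets
(`σ₀ ∈ s² G_ℓ`, §4) carry the boundary-level archimedean bit. [cite: GrossLMS1991, §4 (4.1) and Prop. 5.3] [cite: McCallumLMS1991, §5] -/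
theorem norm_pair_kolyvaginDerivative_smul {σ σ' s s' t t' σ₀ : R} {m k : ℕ} (hσσ' : σ * σ' = 1) (hσ : σ ^ m = 1)
    (τ : M →+ M) (hτ : ∀ x : M, τ (σ • x) = σ' • τ x) (hτs : ∀ x : M, τ (s • x) = s' • τ x)
    (hτt : ∀ x : M, τ (t • x) = t' • τ x) {y : M} (hy : τ y = σ₀ • y) (hst : s' * σ₀ = t * σ ^ k)
    (hts : t' * σ₀ = s * σ ^ k) :
    ((s + t) * ∑ i ∈ range m, (i : R) * σ ^ i) • y + τ (((s + t) * ∑ i ∈ range m, (i : R) * σ ^ i) • y) =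
      (-((m : R) • s • (∑ j ∈ range (k + 1), σ ^ j) • y) + ((m + k : ℕ) : R) • s • (∑ i ∈ range m, σ ^ i) • y) +
        τ (-((m : R) • s • (∑ j ∈ range (k + 1), σ ^ j) • y) +
          ((m + k : ℕ) : R) • s • (∑ i ∈ range m, σ ^ i) • y) := by
  -- right-hand side: `τ Z = −(m • t • G_k • y) + (m+k) • t • Tr • y`
  rw [map_add, map_neg, map_natCast_smul τ m, map_natCast_smul τ (m + k),
    map_smul_sum_pow_smul_of_partner hσσ' τ hτ hτs hy hst, map_smul_trace_smul_of_partner hσσ' hσ τ hτ hτs hy hst]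
  -- left-hand side: `τ((sD)•y) = (t σ^k (m(Tr−1) − D)) • y`, `τ((tD)•y) = (s σ^k (…)) • y`
  rw [add_mul, add_smul, map_add, map_mul_kolyvaginDerivative_smul hσσ' hσ τ hτ hτs hy,
    map_mul_kolyvaginDerivative_smul hσσ' hσ τ hτ hτt hy, hst, hts, mul_assoc t, mul_assoc s,
    pow_mul_reflect_eq hσ k]
  -- both sides are `R`-combinations of the single atom `y`
  simp only [smul_smul]
  module

end Summit.BirchSwinnertonDyer.BirchSwinnertonDyer.Theorems.OffBigImageOddLocalAtTwo.ArchBoundaryNorm
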